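import Summits.ResolutionOfSingularities.ResolutionOfSingularities.Theorems.FrobeniusLadderFRationalResolutionGaloisCharacteristicCentre
import Summits.ResolutionOfSingularities.ResolutionOfSingularities.Theorems.FrobeniusLadderFRationalResolutionBlowupFlatCriteria
import Literature.AlgebraicGeometry.Resolution.BlowupsComposition
import Literature.AlgebraicGeometry.Resolution.MarkedIdealsLemmas
import HarnessLib

/-!
# Crux `FrobeniusLadder.FRationalResolution` (stmt-ResolutionOfSingularities-15317), line `redirect`,
# stub `stub_diagonalizableQuotientResolution` — A CHARACTERISTIC TWO-STEP TOWER IS THE BLOW-UP OF ONE CHARACTERISTIC IDEAL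
# (item (γ)/(Q3) of MEMO-15317-leafhand2-g16 §3: packaging «intrinsic centre, then the intrinsic centre of the first blow-up»
# into the one-ideal interface `…GaloisCharacteristicCentre.hloc_of_characteristic_ideal_adicCompletion`, p838347)

Setting: a Noetherian ring `R`, an ideal `J₁ ⊆ R` mapped into itself by EVERY ring automorphism of `R` (a characteristic ideal),
`p : X₁ = Bl_{J₁}(Spec R) → Spec R` the affine blowing up, and on `X₁` a second centre `𝒦` which is stable under those
automorphisms `Θ` of the SCHEME `X₁` that cover an automorphism of `Spec R` (e.g. any ideal sheaf attached intrinsically to `X₁`,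
such as the reduced ideal of its singular locus). Then the two-step tower `X₂ = Bl_𝒦(X₁) → X₁ → Spec R` is the blowing up of
`Spec R` in ONE ideal `J₂ ⊆ J₁` which is again characteristic. Construction (Stacks 080B made canonical): by the relative
ampleness formula of the tree's `IsBlowup.exists_comap_eq_mul_pow` there are `d` and `𝓠` with `p⁻¹𝓠·𝒪_{X₁} = 𝒦·𝓘_E^d`; the
LARGEST such `𝓠` is the push-forward `𝓠_max := p_*(𝒦·𝓘_E^d)` (Mathlib's Galois connection `Scheme.IdealSheafData.map_gc`), and
`J₂ := J₁ · Q_max`. Every ring automorphism `θ` of `R` fixes `J₁`, hence lifts to an automorphism `Θ` of `X₁` over `Spec θ`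
(uniqueness of blowing ups), which fixes `𝓘_E` and (by hypothesis) `𝒦`, hence `𝒦·𝓘_E^d`, hence — by maximality — `𝓠_max`.

* `map_eq_of_forall_map_le` — an ideal mapped into itself by every ring automorphism is FIXED by every ring automorphism;
* `idealSheaf_mul` / `idealSheaf_pow` / `le_of_idealSheaf_le` / `exists_eq_idealSheaf` — the dictionary ideals of `R` ↔ ideal
  sheaves of `Spec R` (Mathlib `Scheme.IdealSheafData.equivOfIsAffine`) in the tree's `affineBlowup.idealSheaf` normal form;
* `exists_lift_ringEquiv` — **automorphisms of `R` fixing `J₁` lift to automorphisms of `Bl_{J₁}(Spec R)`**;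
* ★ `exists_characteristic_ideal_of_tower` — the packaging theorem: `∃ J₂ d`, `J₂` characteristic, `J₂ ≤ J₁`,
  `IsBlowup (p' ≫ p) J₂~`, and `J₁^{d+1}·M ≤ J₂` for every ideal `M` whose pull-back lies in `𝒦` (primary-ness bookkeeping);
* `isRegular_affineBlowup_of_tower` — if `X₂` is regular then `Bl_{J₂}(Spec R)` is regular;
* ★★ `hloc_of_characteristic_tower_adicCompletion` — the Galois-route interface p838347 fed by a characteristic TWO-STEP tower in
  `Ê = ((B ⊗_K K')_{𝔔'})^`: `J₁ ⊇ (𝔔'Ê)ⁿ` characteristic, `𝒦 ⊇ p⁻¹(𝔔'Ê)ᵇ` stable under the covering automorphisms of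
  `Bl_{J₁}(Spec Ê)`, `Bl_𝒦(Bl_{J₁}(Spec Ê))` regular ⇒ `hloc` at the twisted point (the shape needed by the conifold step of the
  intrinsic class-group recipe, MEMO-15317-leafhand2-g16 §2(c)).

Honest label: plumbing toward ONE leaf stub (no stub, crux or summit closed). No definitions, no named facts, no sorry.
[cite: StacksProject, Tag 080A; Tag 080B; Tag 0806] [cite: GortzWedhorn2020, Prop. 13.91; Prop. 13.92] [folklore]
-/

noncomputable section

-- single-problem summit: the doubled namespace component is forced
set_option linter.dupNamespace false

open CategoryTheory CategoryTheory.Limits AlgebraicGeometry TopologicalSpace TensorProduct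
open Literature.AlgebraicGeometry.Resolution
open Summit.ResolutionOfSingularities.ResolutionOfSingularities.Theorems.FRationalResolution

namespace Summit.ResolutionOfSingularities.ResolutionOfSingularities.Theorems.FRationalResolution.CharacteristicTower

/-! ## §1 Characteristic ideals are fixed, not only mapped into themselves -/

/-- An ideal mapped into itself by EVERY ring automorphism is fixed by every ring automorphism (apply the hypothesis to
`θ⁻¹` and map forward). [folklore] -/
theorem map_eq_of_forall_map_le {R : Type} [CommRing R] {J : Ideal R} (hJ : ∀ θ : R ≃+* R, J.map (θ : R →+* R) ≤ J)
    (θ : R ≃+* R) : J.map (θ : R →+* R) = J := by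
  refine le_antisymm (hJ θ) ?_
  have h : (J.map (θ.symm : R →+* R)).map (θ : R →+* R) ≤ J.map (θ : R →+* R) := Ideal.map_mono (hJ θ.symm)
  rwa [Ideal.map_map, RingEquiv.comp_symm, Ideal.map_id] at h

/-! ## §2 Ideals of `R` versus ideal sheaves of `Spec R` -/

/-- `Γ(Spec R, ⊤) ≅ R`: the two composites of `ΓSpecIso` are identities, as ring maps. [folklore] -/
theorem ΓSpecIso_inv_comp_hom (R : Type) [CommRing R] :
    (Scheme.ΓSpecIso (.of R)).hom.hom.comp (Scheme.ΓSpecIso (.of R)).inv.hom = RingHom.id R := by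
  have h := (Scheme.ΓSpecIso (CommRingCat.of R)).inv_hom_id
  rw [← CommRingCat.hom_comp, h, CommRingCat.hom_id]

/-- The other composite. [folklore] -/
theorem ΓSpecIso_hom_comp_inv (R : Type) [CommRing R] :
    (Scheme.ΓSpecIso (.of R)).inv.hom.comp (Scheme.ΓSpecIso (.of R)).hom.hom = RingHom.id _ := by
  have h := (Scheme.ΓSpecIso (CommRingCat.of R)).hom_inv_id
  rw [← CommRingCat.hom_comp, h, CommRingCat.hom_id]

/-- `(J J')~ = J~ · J'~`. [folklore] -/
theorem idealSheaf_mul {R : Type} [CommRing R] (J J' : Ideal R) :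
    affineBlowup.idealSheaf (J * J') = affineBlowup.idealSheaf J * affineBlowup.idealSheaf J' := by
  simp only [affineBlowup.idealSheaf, Ideal.map_mul, ← Scheme.IdealSheafData.equivOfIsAffine_symm_apply, map_mul]

/-- `(Jⁿ)~ = (J~)ⁿ`. [folklore] -/
theorem idealSheaf_pow {R : Type} [CommRing R] (J : Ideal R) (n : ℕ) :
    affineBlowup.idealSheaf (J ^ n) = affineBlowup.idealSheaf J ^ n := by
  simp only [affineBlowup.idealSheaf, Ideal.map_pow, ← Scheme.IdealSheafData.equivOfIsAffine_symm_apply, map_pow]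

/-- `J~ ≤ J'~ ⇒ J ≤ J'` (the dictionary is an order isomorphism). [folklore] -/
theorem le_of_idealSheaf_le {R : Type} [CommRing R] {J J' : Ideal R}
    (h : affineBlowup.idealSheaf J ≤ affineBlowup.idealSheaf J') : J ≤ J' := by
  simp only [affineBlowup.idealSheaf, ← Scheme.IdealSheafData.equivOfIsAffine_symm_apply, map_le_map_iff] at h
  have h' := Ideal.map_mono (f := (Scheme.ΓSpecIso (.of R)).hom.hom) h
  rwa [Ideal.map_map, Ideal.map_map, ΓSpecIso_inv_comp_hom, Ideal.map_id, Ideal.map_id] at h'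

/-- `J ≤ J' ⇒ J~ ≤ J'~`. [folklore] -/
theorem idealSheaf_le_of_le {R : Type} [CommRing R] {J J' : Ideal R} (h : J ≤ J') :
    affineBlowup.idealSheaf J ≤ affineBlowup.idealSheaf J' := by
  simp only [affineBlowup.idealSheaf, ← Scheme.IdealSheafData.equivOfIsAffine_symm_apply, map_le_map_iff]
  exact Ideal.map_mono h

/-- Every ideal sheaf of `Spec R` is `J~` for an ideal `J ⊆ R`. [folklore] -/
theorem exists_eq_idealSheaf {R : Type} [CommRing R] (𝓠 : (Spec (.of R)).IdealSheafData) :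
    ∃ J : Ideal R, affineBlowup.idealSheaf J = 𝓠 := by
  refine ⟨(Scheme.IdealSheafData.equivOfIsAffine 𝓠).map (Scheme.ΓSpecIso (.of R)).hom.hom, ?_⟩
  rw [affineBlowup.idealSheaf, Ideal.map_map, ΓSpecIso_hom_comp_inv, Ideal.map_id,
    ← Scheme.IdealSheafData.equivOfIsAffine_symm_apply]
  exact (Scheme.IdealSheafData.equivOfIsAffine (X := Spec (.of R))).symm_apply_apply 𝓠

/-! ## §3 Lifting ring automorphisms to the blowing up of a characteristic ideal -/

/-- `Spec θ ≫ Spec θ⁻¹ = 𝟙`. [folklore] -/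
theorem specMap_ringEquiv_comp_symm {R : Type} [CommRing R] (θ : R ≃+* R) :
    Spec.map (CommRingCat.ofHom (θ : R →+* R)) ≫ Spec.map (CommRingCat.ofHom (θ.symm : R →+* R)) = 𝟙 _ := by
  rw [← Spec.map_comp, ← CommRingCat.ofHom_comp, RingEquiv.comp_symm, CommRingCat.ofHom_id, Spec.map_id]

/-- **Automorphisms of `R` fixing `J` lift to automorphisms of `Bl_J(Spec R)`**: for a ring automorphism `θ` with `θ(J) = J`
there is an automorphism `Θ` of the scheme `Bl_J(Spec R)` with `Θ ≫ π = π ≫ Spec θ` (uniqueness of blowing ups: `π ≫ Spec θ`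
is again a blowing up of `Spec R` in `(Spec θ⁻¹)⁻¹ J~ = (θ⁻¹ J)~ = J~`). [cite: GortzWedhorn2020, Prop. 13.91 (1); Prop. 13.92] -/
theorem exists_lift_ringEquiv {R : Type} [CommRing R] (J : Ideal R) (θ : R ≃+* R)
    (hθ : J.map (θ : R →+* R) = J) :
    ∃ Θ : affineBlowup J ≅ affineBlowup J,
      Θ.hom ≫ affineBlowup.π J = affineBlowup.π J ≫ Spec.map (CommRingCat.ofHom (θ : R →+* R)) := by
  -- `θ⁻¹` fixes `J` as well
  have hθ' : J.map (θ.symm : R →+* R) = J := by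
    have h := congrArg (Ideal.map (θ.symm : R →+* R)) hθ
    rw [Ideal.map_map, RingEquiv.symm_comp, Ideal.map_id] at h
    exact h.symm
  -- the automorphism `Spec θ` of `Spec R` as an isomorphism with explicit inverse `Spec θ⁻¹`
  let σ : Spec (.of R) ≅ Spec (.of R) :=
    ⟨Spec.map (CommRingCat.ofHom (θ : R →+* R)), Spec.map (CommRingCat.ofHom (θ.symm : R →+* R)),
      specMap_ringEquiv_comp_symm θ, by
        have h := specMap_ringEquiv_comp_symm θ.symm
        rwa [RingEquiv.symm_symm] at h⟩
  have h1 : IsBlowup (affineBlowup.π J ≫ σ.hom) ((affineBlowup.idealSheaf J).comap σ.inv) :=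
    (affineBlowup.isBlowup J).comp_iso σ
  have h2 : (affineBlowup.idealSheaf J).comap σ.inv = affineBlowup.idealSheaf J := by
    change (affineBlowup.idealSheaf J).comap (Spec.map (CommRingCat.ofHom (θ.symm : R →+* R))) = _
    rw [BlowupFlatCriteria.idealSheaf_comap_specMap, hθ']
  rw [h2] at h1
  obtain ⟨e, -, he⟩ := (affineBlowup.isBlowup J).unique h1
  exact ⟨e.symm, he⟩

/-! ## §4 The packaging theorem -/

/-- Pull-backs along a covering pair: if `Θ ≫ p = p ≫ σ` then `Θ⁻¹(p⁻¹𝓠) = p⁻¹(σ⁻¹𝓠)` as ideal sheaves. [folklore] -/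
theorem comap_comap_of_comm {X Y : Scheme.{0}} {p : X ⟶ Y} {Θ : X ⟶ X} {σ : Y ⟶ Y} (h : Θ ≫ p = p ≫ σ)
    (𝓠 : Y.IdealSheafData) : (𝓠.comap p).comap Θ = (𝓠.comap σ).comap p := by
  rw [← Scheme.IdealSheafData.comap_comp, ← Scheme.IdealSheafData.comap_comp, h]

/-- ★ **A characteristic two-step tower is the blowing up of one characteristic ideal.** `R` Noetherian; `J₁` characteristic
(`θ J₁ ⊆ J₁` for every ring automorphism `θ`); `p : X₁ = Bl_{J₁}(Spec R) → Spec R`; `𝒦` an ideal sheaf on `X₁` with `Θ⁻¹𝒦 ⊆ 𝒦`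
for every automorphism `Θ` of `X₁` covering an automorphism of `Spec R`; `p' : X₂ → X₁` a blowing up in `𝒦`. Then there are an
ideal `J₂ ⊆ J₁` and `d ∈ ℕ` with: `J₂` characteristic; `p' ≫ p` is a blowing up of `Spec R` in `J₂`; and `J₁^{d+1}·M ⊆ J₂` for
every ideal `M` with `p⁻¹M~ ⊆ 𝒦`. (`J₂ = J₁ · Q` with `Q~ = p_*(𝒦·𝓘_E^d)`.)
[cite: StacksProject, Tag 080A; Tag 080B] [cite: GortzWedhorn2020, Prop. 13.91] -/
theorem exists_characteristic_ideal_of_tower {R : Type} [CommRing R] [IsNoetherianRing R]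
    (J₁ : Ideal R) (hJ₁ : ∀ θ : R ≃+* R, J₁.map (θ : R →+* R) ≤ J₁)
    (𝒦 : (affineBlowup J₁).IdealSheafData)
    (h𝒦 : ∀ Θ : affineBlowup J₁ ≅ affineBlowup J₁,
      (∃ σ : Spec (.of R) ⟶ Spec (.of R), Θ.hom ≫ affineBlowup.π J₁ = affineBlowup.π J₁ ≫ σ) →
      𝒦.comap Θ.hom ≤ 𝒦)
    {X₂ : Scheme.{0}} (p' : X₂ ⟶ affineBlowup J₁) (hp' : IsBlowup p' 𝒦) :
    ∃ (J₂ : Ideal R) (d : ℕ), (∀ θ : R ≃+* R, J₂.map (θ : R →+* R) ≤ J₂) ∧ J₂ ≤ J₁ ∧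
      IsBlowup (p' ≫ affineBlowup.π J₁) (affineBlowup.idealSheaf J₂) ∧
      ∀ M : Ideal R, (affineBlowup.idealSheaf M).comap (affineBlowup.π J₁) ≤ 𝒦 → J₁ ^ (d + 1) * M ≤ J₂ := by
  haveI : IsNoetherian (Spec (.of R)) := inferInstance
  set p := affineBlowup.π J₁ with hp
  set E := (affineBlowup.idealSheaf J₁).comap p with hE
  have hbl : IsBlowup p (affineBlowup.idealSheaf J₁) := affineBlowup.isBlowup J₁
  -- Stacks 080B: the relative ampleness formula
  obtain ⟨d, 𝓠₀, h𝓠₀⟩ := hbl.exists_comap_eq_mul_pow 𝒦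
  -- the canonical (largest) solution: the push-forward
  set 𝓠 := (𝒦 * E ^ d).map p with h𝓠
  have hle : 𝓠.comap p ≤ 𝒦 * E ^ d := Scheme.IdealSheafData.comap_map_le _ _
  have h𝓠₀le : 𝓠₀ ≤ 𝓠 := Scheme.IdealSheafData.le_map_iff_comap_le.mpr h𝓠₀.le
  have hmax : 𝓠.comap p = 𝒦 * E ^ d := by
    refine le_antisymm hle ?_
    rw [← h𝓠₀]
    exact Scheme.IdealSheafData.comap_mono p h𝓠₀le
  -- the ideal `Q` of `R` with `Q~ = 𝓠`, and `J₂ := J₁ Q`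
  obtain ⟨Q, hQ⟩ := exists_eq_idealSheaf 𝓠
  refine ⟨J₁ * Q, d, fun θ => ?_, Ideal.mul_le_right, ?_, fun M hM => ?_⟩
  · -- characteristic
    have hθ : J₁.map (θ : R →+* R) = J₁ := map_eq_of_forall_map_le hJ₁ θ
    obtain ⟨Θ, hΘ⟩ := exists_lift_ringEquiv J₁ θ hθ
    set σ := Spec.map (CommRingCat.ofHom (θ : R →+* R)) with hσ
    have h𝒦Θ : 𝒦.comap Θ.hom ≤ 𝒦 := h𝒦 Θ ⟨σ, hΘ⟩
    have hEΘ : E.comap Θ.hom = E := by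
      rw [hE, comap_comap_of_comm hΘ, BlowupFlatCriteria.idealSheaf_comap_specMap, hθ]
    have hQσ : 𝓠.comap σ ≤ 𝓠 := by
      rw [h𝓠, Scheme.IdealSheafData.le_map_iff_comap_le, ← h𝓠, ← comap_comap_of_comm hΘ, hmax, comap_mul, comap_pow,
        hEΘ]
      exact mul_le_mul_of_nonneg_right h𝒦Θ bot_le
    rw [← hQ, BlowupFlatCriteria.idealSheaf_comap_specMap] at hQσ
    have hQθ : Q.map (θ : R →+* R) ≤ Q := le_of_idealSheaf_le hQσ
    rw [Ideal.map_mul, hθ]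
    exact Ideal.mul_mono_right hQθ
  · -- the composite is the blowing up in `J₁ Q`
    have hp'' : IsBlowup p' (𝓠.comap p) := by
      rw [hmax]
      exact hp'.mul_of_isEffectiveCartier (hbl.isEffectiveCartier.pow d)
    have h := hbl.comp hp''
    rw [← hQ, ← idealSheaf_mul] at h
    exact h
  · -- primary-ness bookkeeping
    have h1 : (affineBlowup.idealSheaf (J₁ ^ d * M)).comap p ≤ 𝒦 * E ^ d := by
      rw [idealSheaf_mul, idealSheaf_pow, comap_mul, comap_pow, ← hE, mul_comm]
      exact mul_le_mul_of_nonneg_right hM bot_le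
    have h2 : affineBlowup.idealSheaf (J₁ ^ d * M) ≤ 𝓠 := Scheme.IdealSheafData.le_map_iff_comap_le.mpr h1
    rw [← hQ] at h2
    have h3 : J₁ ^ d * M ≤ Q := le_of_idealSheaf_le h2
    rw [pow_succ', mul_assoc]
    exact Ideal.mul_mono_right h3

/-- **Regularity transfer**: in the situation of `exists_characteristic_ideal_of_tower`, if the top of the tower `X₂` is regular
then `Bl_{J₂}(Spec R)` is regular (uniqueness of blowing ups). [cite: GortzWedhorn2020, Prop. 13.91 (1)] -/
theorem isRegular_affineBlowup_of_isBlowup {R : Type} [CommRing R] {X₂ : Scheme.{0}} {q : X₂ ⟶ Spec (.of R)} {J₂ : Ideal R}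
    (hq : IsBlowup q (affineBlowup.idealSheaf J₂)) (hreg : Scheme.IsRegular X₂) :
    Scheme.IsRegular (affineBlowup J₂) := by
  obtain ⟨e, -, -⟩ := hq.unique (affineBlowup.isBlowup J₂)
  exact Scheme.IsRegular.of_iso e.hom hreg

/-- ★ **The packaged statement in the shape of the one-ideal interface**: from a characteristic `J₁ ⊇ 𝔪ⁿ`, `J₁ ≠ ⊤`, a covering-
automorphism-stable `𝒦 ⊇ p⁻¹(𝔪ᵇ)~` on `Bl_{J₁}` and a REGULAR blowing up of `Bl_{J₁}` in `𝒦`, a characteristic ideal `J₂` with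
`𝔪^c ⊆ J₂`, `J₂ ≠ ⊤` and `Bl_{J₂}(Spec R)` regular (`𝔪` any ideal here). [cite: StacksProject, Tag 080B] [folklore] -/
theorem exists_characteristic_ideal_isRegular_of_tower {R : Type} [CommRing R] [IsNoetherianRing R]
    (𝔪 J₁ : Ideal R) {n b : ℕ} (hn : 𝔪 ^ n ≤ J₁) (hJ₁top : J₁ ≠ ⊤)
    (hJ₁ : ∀ θ : R ≃+* R, J₁.map (θ : R →+* R) ≤ J₁)
    (𝒦 : (affineBlowup J₁).IdealSheafData)
    (h𝒦 : ∀ Θ : affineBlowup J₁ ≅ affineBlowup J₁,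
      (∃ σ : Spec (.of R) ⟶ Spec (.of R), Θ.hom ≫ affineBlowup.π J₁ = affineBlowup.π J₁ ≫ σ) →
      𝒦.comap Θ.hom ≤ 𝒦)
    (hb : (affineBlowup.idealSheaf (𝔪 ^ b)).comap (affineBlowup.π J₁) ≤ 𝒦)
    {X₂ : Scheme.{0}} (p' : X₂ ⟶ affineBlowup J₁) (hp' : IsBlowup p' 𝒦) (hreg : Scheme.IsRegular X₂) :
    ∃ (J₂ : Ideal R) (c : ℕ), (∀ θ : R ≃+* R, J₂.map (θ : R →+* R) ≤ J₂) ∧ 𝔪 ^ c ≤ J₂ ∧ J₂ ≠ ⊤ ∧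
      Scheme.IsRegular (affineBlowup J₂) := by
  obtain ⟨J₂, d, hchar, hle, hbl, hprim⟩ := exists_characteristic_ideal_of_tower J₁ hJ₁ 𝒦 h𝒦 p' hp'
  refine ⟨J₂, n * (d + 1) + b, hchar, ?_, fun h => hJ₁top (top_le_iff.mp (h ▸ hle)), isRegular_affineBlowup_of_isBlowup hbl hreg⟩
  calc 𝔪 ^ (n * (d + 1) + b) = (𝔪 ^ n) ^ (d + 1) * 𝔪 ^ b := by rw [pow_add, pow_mul]
    _ ≤ J₁ ^ (d + 1) * 𝔪 ^ b := Ideal.mul_mono_left (Ideal.pow_right_mono hn _)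
    _ ≤ J₂ := hprim _ hb

/-! ## §5 The Galois-route interface fed by a characteristic tower in `Ê` -/

/-- ★★ **`hloc` FROM A CHARACTERISTIC TWO-STEP TOWER OF THE COMPLETE LOCAL RING.** Data as in
`…GaloisCharacteristicCentre.hloc_of_characteristic_ideal_adicCompletion` (p838347), but instead of one characteristic ideal with
regular blowing up: a characteristic proper ideal `J₁ ⊇ (𝔔'Ê)ⁿ` of `Ê = ((B ⊗_K K')_{𝔔'})^`, an ideal sheaf `𝒦 ⊇ p⁻¹((𝔔'Ê)ᵇ)~` on
`Bl_{J₁}(Spec Ê)` stable under the automorphisms of `Bl_{J₁}(Spec Ê)` covering automorphisms of `Spec Ê`, and a REGULAR blowing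
up of `Bl_{J₁}(Spec Ê)` in `𝒦`. (Intended use, MEMO-15317-leafhand2-g16 §2(c): `J₁` = a power of the product of the trace ideals of
the divisorial classes, `𝒦` = the reduced ideal of the finitely many conifold points of its blowing up.)
[cite: StacksProject, Tag 080B; Tag 0CDQ; Tag 09EB] [cite: Matsumura1987, Thm. 8.11; Thm. 8.14] -/
theorem hloc_of_characteristic_tower_adicCompletion (K : Type) [Field K] (X : Scheme.{0}) [IsIntegral X]
    (f : X ⟶ Spec (.of K)) [LocallyOfFiniteType f]
    {B : Type} [CommRing B] [IsDomain B] [Algebra K B] [Algebra.FiniteType K B]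
    (ι : Spec (.of B) ⟶ X) [IsOpenImmersion ι] (hι : ι ≫ f = Spec.map (CommRingCat.ofHom (algebraMap K B)))
    (𝔭 : Ideal B) [h𝔭 : 𝔭.IsMaximal] (h𝔭0 : 𝔭 ≠ ⊥)
    (hsing : ι ⟨𝔭, h𝔭.isPrime⟩ ∉ Scheme.regularLocus X)
    (hregB : ∀ P : Spec (.of B), P.asIdeal ≠ 𝔭 → P ∈ Scheme.regularLocus (Spec (.of B)))
    (K' : Type) [Field K'] [Algebra K K'] [FiniteDimensional K K'] [IsGalois K K']
    (𝔔' : Ideal (B ⊗[K] K')) [h𝔔' : 𝔔'.IsMaximal] (h𝔔'𝔭 : 𝔔'.comap (algebraMap B (B ⊗[K] K')) = 𝔭)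
    (J₁ : Ideal (AdicCompletion (IsLocalRing.maximalIdeal (Localization.AtPrime 𝔔')) (Localization.AtPrime 𝔔')))
    {n b : ℕ}
    (hpJ : 𝔔'.map (algebraMap (B ⊗[K] K')
      (AdicCompletion (IsLocalRing.maximalIdeal (Localization.AtPrime 𝔔')) (Localization.AtPrime 𝔔'))) ^ n ≤ J₁)
    (hJp : J₁ ≠ ⊤)
    (hchar : ∀ θ : AdicCompletion (IsLocalRing.maximalIdeal (Localization.AtPrime 𝔔')) (Localization.AtPrime 𝔔') ≃+*
        AdicCompletion (IsLocalRing.maximalIdeal (Localization.AtPrime 𝔔')) (Localization.AtPrime 𝔔'), J₁.map (θ : _ →+* _) ≤ J₁)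
    (𝒦 : (affineBlowup J₁).IdealSheafData)
    (h𝒦 : ∀ Θ : affineBlowup J₁ ≅ affineBlowup J₁,
      (∃ σ : Spec (.of (AdicCompletion (IsLocalRing.maximalIdeal (Localization.AtPrime 𝔔')) (Localization.AtPrime 𝔔'))) ⟶
          Spec (.of (AdicCompletion (IsLocalRing.maximalIdeal (Localization.AtPrime 𝔔')) (Localization.AtPrime 𝔔'))),
        Θ.hom ≫ affineBlowup.π J₁ = affineBlowup.π J₁ ≫ σ) →
      𝒦.comap Θ.hom ≤ 𝒦)
    (hb : (affineBlowup.idealSheaf (𝔔'.map (algebraMap (B ⊗[K] K')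
      (AdicCompletion (IsLocalRing.maximalIdeal (Localization.AtPrime 𝔔')) (Localization.AtPrime 𝔔'))) ^ b)).comap
        (affineBlowup.π J₁) ≤ 𝒦)
    {X₂ : Scheme.{0}} (p' : X₂ ⟶ affineBlowup J₁) (hp' : IsBlowup p' 𝒦) (hreg : Scheme.IsRegular X₂) :
    ∃ (V : X.Opens), ι ⟨𝔭, h𝔭.isPrime⟩ ∈ V ∧
      (∀ t : X, t ∉ Scheme.regularLocus X → t ∈ V → t = ι ⟨𝔭, h𝔭.isPrime⟩) ∧
      ∃ (Y : Scheme.{0}) (ρ : Y ⟶ V), IsProper ρ ∧ Scheme.IsRegular Y ∧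
        IsIso (ρ ∣_ (V.ι ⁻¹ᵁ ⟨Scheme.regularLocus X, isOpen_regularLocus_of_locallyOfFiniteType_field f⟩)) ∧
        Dense ((ρ ⁻¹ᵁ (V.ι ⁻¹ᵁ ⟨Scheme.regularLocus X,
          isOpen_regularLocus_of_locallyOfFiniteType_field f⟩) : Y.Opens) : Set Y) := by
  haveI : IsNoetherianRing B := Algebra.FiniteType.isNoetherianRing K B
  haveI : Algebra.FiniteType B (B ⊗[K] K') := inferInstance
  haveI : IsNoetherianRing (B ⊗[K] K') := Algebra.FiniteType.isNoetherianRing B (B ⊗[K] K')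
  haveI : IsNoetherianRing (Localization.AtPrime 𝔔') :=
    IsLocalization.isNoetherianRing 𝔔'.primeCompl (Localization.AtPrime 𝔔') inferInstance
  haveI : IsNoetherianRing (AdicCompletion (IsLocalRing.maximalIdeal (Localization.AtPrime 𝔔')) (Localization.AtPrime 𝔔')) :=
    isNoetherianRing_adicCompletion_maximalIdeal _
  obtain ⟨J₂, c, hchar₂, hc, hJ₂top, hreg₂⟩ :=
    exists_characteristic_ideal_isRegular_of_tower _ J₁ hpJ hJp hchar 𝒦 h𝒦 hb p' hp' hreg
  exact GaloisCharacteristicCentre.hloc_of_characteristic_ideal_adicCompletion K X f ι hι 𝔭 h𝔭0 hsing hregB K' 𝔔' h𝔔'𝔭 J₂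
    hc hJ₂top (fun θ => hchar₂ θ) hreg₂

end Summit.ResolutionOfSingularities.ResolutionOfSingularities.Theorems.FRationalResolution.CharacteristicTower

end
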